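import Summits.HodgeConjecture.CorCM.MultiFieldWeilDecicTower
import HarnessLib

/-!
# MULTI-FIELD WEIL ENGINE — SEXTIC AND DECIC TOWERS TOGETHER: ANY NUMBER of `(1,2)`-threefolds over sextic CM fields AND `(2,3)`-fivefolds over decic CM fields
# sharing `k`, each field admitting NO `k`-embedding into the compositum of the EARLIER fields OF THE SAME DEGREE — the Hodge conjecture for every product of
# copies, given ONLY Markman's fourfold and hyperbolic-sixfold theorems

Cell `pub-hodgecm2` (COR-CM), seat b30 gen 32 (2026-08-24); count-neutral own lane MULTI-FIELD WEIL ENGINE (stem `MultiFieldWeil*`).  The capstone of the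
field-intrinsic Markman-only headlines of gen 32: it combines the CUBIC TOWER (`CorCM/MultiFieldWeilCubicTower.lean`, one cubic step
`finrank_sup_adjoin_range_of_forall_not_range_subset`) and the QUINTIC ∕ DECIC TOWER (`CorCM/MultiFieldWeilQuinticTower.lean`, `CorCM/MultiFieldWeilDecicTower.lean`, one
quintic step `finrank_sup_adjoin_range_of_forall_not_range_subset_five`) through G2b's per-degree-class headline
`hodgeConjectureFor_biproduct_comp_of_sexticsDecics_of_finrank` (`CorCM/MultiFieldWeilGaloisHeadlines.lean`).  Theorems only; no definition, no named fact, no `sorry`.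
HONEST FRAMING: conditional on the two displayed Markman binders only; `HC_CM` is NOT proved and not asserted.

* §1 **`finrank_adjoin_biUnion_of_cubicTower`**, **`finrank_adjoin_biUnion_of_quinticTower`** — the towers over an arbitrary FINSET `S` of indices in a linear order
  (induction on the maximum, Mathlib `Finset.induction_on_max`): relative cubics (resp. quintics) `K_m`, `m ∈ S`, each with no `τ`-embedding into
  `ℚ(τk) · ∏_{j ∈ S, j < m} s_j(K_j)`, have compositum of degree `3^{|S|} [k : ℚ]` (resp. `5^{|S|} [k : ℚ]`).  (The `Fin r`-indexed forms are
  `finrank_adjoin_iUnion_of_cubicTower` ∕ `…_of_quinticTower`; the finset form is what a degree CLASS inside a mixed family needs.)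
* §2 **`hodgeConjectureFor_biproduct_comp_of_sexticsDecics_of_towers`** (+ dominated) — THE HEADLINE: `E = A 0 ⊨ (k; {τ})`; fields `K_m = Kf (is m)` (`m : Fin r`) of
  degrees `2 n_m`, `n_m ∈ {3, 5}`, containing `k`, with `A (m+1) ⊨ (K_m; Φ (m+1))` of `p_m ∈ {1, 2}` members over `τ` (`(n, p) = (3, 1)` or `(5, 2)`); ONE family `s₀`
  of `τ`-embeddings such that for every `m` NO `τ`-embedding of `K_m` has image inside `ℚ(τk) · ∏_{j < m, n_j = n_m} s₀_j(K_j)`.  Then the Hodge conjecture holds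
  for EVERY product of copies `⨁_j A (κ j)`, GIVEN ONLY `Markman2025_weilClasses_algebraic_abelianFourfold` and `Markman2025_weilClasses_algebraic_hyperbolicSixfold`.
  Special cases: Q3 §3 (all sextic), Q7 §3 (all decic), Q2 §3 (`6,6,10,10`), Q5 (`6,6,10` ∕ `6,10,10`).

[cite: Markman2025SurveySecant, Thm. 1.2] [cite: Markman2025SecantWeil, Thm 1.5.1] [cite: Lang2002, V §1 Prop. 1.2, VI §1 Thm. 1.1, Cor. 1.6 and V §2 Thm. 2.8]

## References
* [Markman2025SurveySecant] E. Markman, arXiv:2509.23403, Thm. 1.2.  [Markman2025SecantWeil] E. Markman, Thm 1.5.1.  [Lang2002] S. Lang, *Algebra*, GTM 211, V §1–§2, VI §1.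
-/

noncomputable section

open CategoryTheory CategoryTheory.Limits NumberField IntermediateField Polynomial

namespace Summit.HodgeConjecture.CorCM.MultiFieldWeil

open Finset
open Literature.AlgebraicGeometry Literature.AlgebraicGeometry.Motives Literature.AlgebraicGeometry.HodgeTheory
open Literature.AlgebraicGeometry.ComplexMultiplication (IsCMTypeRealisation)
open Literature.AlgebraicTopology.SingularHomology
open Literature.NumberTheory.ComplexMultiplication

open scoped Classical

/-! ## §1 The towers over a finset of indices -/

section FinsetTower

variable {k : Type} [Field k] [NumberField k] {ι : Type} [LinearOrder ι] {K : ι → Type} [∀ m, Field (K m)] [∀ m, NumberField (K m)]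

omit [LinearOrder ι] [∀ m, NumberField (K m)] in
/-- The union over the empty finset (bookkeeping). [folklore] -/
theorem biUnion_range_empty (s : ∀ m : ι, K m →+* ℂ) : (⋃ m ∈ (∅ : Finset ι), Set.range (s m)) = ∅ := by
  ext x
  simp

/-- **THE CUBIC TOWER OVER A FINSET.**  Relative cubics `K_m ⊇ k` (`m ∈ S`) with embeddings `s_m` over `τ`, each admitting no `τ`-embedding into
`ℚ(τk) · ∏_{j ∈ S, j < m} s_j(K_j)`: the compositum `ℚ(τk) · ∏_{m ∈ S} s_m(K_m)` has degree `3^{|S|} [k : ℚ]`. [cite: Lang2002, V §1 Prop. 1.2, VI §1 Thm. 1.1] -/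
theorem finrank_adjoin_biUnion_of_cubicTower (i : ∀ m, k →+* K m) {τ : k →+* ℂ} (s : ∀ m, K m →+* ℂ) (hs : ∀ m, (s m).comp (i m) = τ) (S : Finset ι) :
    (∀ m ∈ S, Module.finrank ℚ (K m) = 3 * Module.finrank ℚ k) →
    (∀ m ∈ S, ∀ φ : K m →+* ℂ, φ.comp (i m) = τ →
      ¬ Set.range φ ⊆ (↑(adjoin ℚ (Set.range τ) ⊔ adjoin ℚ (⋃ j ∈ S.filter (· < m), Set.range (s j))) : Set ℂ)) →
    Module.finrank ℚ ↥(adjoin ℚ (Set.range τ) ⊔ adjoin ℚ (⋃ m ∈ S, Set.range (s m))) = 3 ^ S.card * Module.finrank ℚ k := by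
  induction S using Finset.induction_on_max with
  | empty =>
    intro _ _
    rw [biUnion_range_empty, adjoin_empty, sup_bot_eq, finrank_adjoin_range_ringHom, Finset.card_empty, pow_zero, one_mul]
  | insert a S haS ih =>
    intro h₃ hK
    have haS' : a ∉ S := fun h => lt_irrefl a (haS a h)
    -- the compositum `A` over `S`, of degree `3^{|S|} [k : ℚ]` by induction
    have hA : Module.finrank ℚ ↥(adjoin ℚ (Set.range τ) ⊔ adjoin ℚ (⋃ m ∈ S, Set.range (s m))) = 3 ^ S.card * Module.finrank ℚ k := by
      refine ih (fun m hm => h₃ m (Finset.mem_insert_of_mem hm)) fun m hm φ hφ hsub => hK m (Finset.mem_insert_of_mem hm) φ hφ (hsub.trans ?_)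
      refine SetLike.coe_subset_coe.2 (sup_le_sup_left (adjoin.mono ℚ _ _ (Set.biUnion_subset_biUnion_left fun j hj => ?_)) _)
      exact Finset.filter_subset_filter _ (Finset.subset_insert a S) hj
    haveI : FiniteDimensional ℚ ↥(adjoin ℚ (Set.range τ) ⊔ adjoin ℚ (⋃ m ∈ S, Set.range (s m))) :=
      Module.finite_of_finrank_pos (by rw [hA]; exact mul_pos (pow_pos (by norm_num) _) Module.finrank_pos)
    have hτA : ∀ x, τ x ∈ adjoin ℚ (Set.range τ) ⊔ adjoin ℚ (⋃ m ∈ S, Set.range (s m)) := fun x =>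
      (le_sup_left : adjoin ℚ (Set.range τ) ≤ _) (subset_adjoin ℚ _ ⟨x, rfl⟩)
    -- the new field is linearly disjoint from `A`
    have hlast : ∀ φ : K a →+* ℂ, φ.comp (i a) = τ → ¬ Set.range φ ⊆ (↑(adjoin ℚ (Set.range τ) ⊔ adjoin ℚ (⋃ m ∈ S, Set.range (s m))) : Set ℂ) := by
      intro φ hφ hsub
      refine hK a (Finset.mem_insert_self a S) φ hφ (hsub.trans (SetLike.coe_subset_coe.2 (sup_le_sup_left (adjoin.mono ℚ _ _
        (Set.biUnion_subset_biUnion_left fun m hm => ?_)) _)))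
      exact Finset.mem_filter.2 ⟨Finset.mem_insert_of_mem hm, haS m hm⟩
    have hstep := finrank_sup_adjoin_range_of_forall_not_range_subset (i a) (h₃ a (Finset.mem_insert_self a S)) _ hτA (hs a) hlast
    rw [Finset.set_biUnion_insert, adjoin_union,
      show adjoin ℚ (Set.range (s a)) ⊔ adjoin ℚ (⋃ m ∈ S, Set.range (s m)) = adjoin ℚ (⋃ m ∈ S, Set.range (s m)) ⊔ adjoin ℚ (Set.range (s a)) from sup_comm _ _,
      ← sup_assoc, hstep, hA, Finset.card_insert_of_notMem haS', pow_succ]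
    ring

/-- **THE QUINTIC TOWER OVER A FINSET.**  As `finrank_adjoin_biUnion_of_cubicTower` with relative QUINTICS: degree `5^{|S|} [k : ℚ]` (each step is the quintic step
over the base of `5`-power degree `5^{|S'|} [k : ℚ]` built so far). [cite: Lang2002, V §1 Prop. 1.2, VI §1 Thm. 1.1] -/
theorem finrank_adjoin_biUnion_of_quinticTower (i : ∀ m, k →+* K m) {τ : k →+* ℂ} (s : ∀ m, K m →+* ℂ) (hs : ∀ m, (s m).comp (i m) = τ) (S : Finset ι) :
    (∀ m ∈ S, Module.finrank ℚ (K m) = 5 * Module.finrank ℚ k) →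
    (∀ m ∈ S, ∀ φ : K m →+* ℂ, φ.comp (i m) = τ →
      ¬ Set.range φ ⊆ (↑(adjoin ℚ (Set.range τ) ⊔ adjoin ℚ (⋃ j ∈ S.filter (· < m), Set.range (s j))) : Set ℂ)) →
    Module.finrank ℚ ↥(adjoin ℚ (Set.range τ) ⊔ adjoin ℚ (⋃ m ∈ S, Set.range (s m))) = 5 ^ S.card * Module.finrank ℚ k := by
  induction S using Finset.induction_on_max with
  | empty =>
    intro _ _
    rw [biUnion_range_empty, adjoin_empty, sup_bot_eq, finrank_adjoin_range_ringHom, Finset.card_empty, pow_zero, one_mul]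
  | insert a S haS ih =>
    intro h₅ hK
    have haS' : a ∉ S := fun h => lt_irrefl a (haS a h)
    have hA : Module.finrank ℚ ↥(adjoin ℚ (Set.range τ) ⊔ adjoin ℚ (⋃ m ∈ S, Set.range (s m))) = 5 ^ S.card * Module.finrank ℚ k := by
      refine ih (fun m hm => h₅ m (Finset.mem_insert_of_mem hm)) fun m hm φ hφ hsub => hK m (Finset.mem_insert_of_mem hm) φ hφ (hsub.trans ?_)
      refine SetLike.coe_subset_coe.2 (sup_le_sup_left (adjoin.mono ℚ _ _ (Set.biUnion_subset_biUnion_left fun j hj => ?_)) _)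
      exact Finset.filter_subset_filter _ (Finset.subset_insert a S) hj
    haveI : FiniteDimensional ℚ ↥(adjoin ℚ (Set.range τ) ⊔ adjoin ℚ (⋃ m ∈ S, Set.range (s m))) :=
      Module.finite_of_finrank_pos (by rw [hA]; exact mul_pos (pow_pos (by norm_num) _) Module.finrank_pos)
    have hτA : ∀ x, τ x ∈ adjoin ℚ (Set.range τ) ⊔ adjoin ℚ (⋃ m ∈ S, Set.range (s m)) := fun x =>
      (le_sup_left : adjoin ℚ (Set.range τ) ≤ _) (subset_adjoin ℚ _ ⟨x, rfl⟩)
    have hlast : ∀ φ : K a →+* ℂ, φ.comp (i a) = τ → ¬ Set.range φ ⊆ (↑(adjoin ℚ (Set.range τ) ⊔ adjoin ℚ (⋃ m ∈ S, Set.range (s m))) : Set ℂ) := by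
      intro φ hφ hsub
      refine hK a (Finset.mem_insert_self a S) φ hφ (hsub.trans (SetLike.coe_subset_coe.2 (sup_le_sup_left (adjoin.mono ℚ _ _
        (Set.biUnion_subset_biUnion_left fun m hm => ?_)) _)))
      exact Finset.mem_filter.2 ⟨Finset.mem_insert_of_mem hm, haS m hm⟩
    have hstep := finrank_sup_adjoin_range_of_forall_not_range_subset_five (i a) (h₅ a (Finset.mem_insert_self a S)) _ hA hτA (hs a) hlast
    rw [Finset.set_biUnion_insert, adjoin_union,
      show adjoin ℚ (Set.range (s a)) ⊔ adjoin ℚ (⋃ m ∈ S, Set.range (s m)) = adjoin ℚ (⋃ m ∈ S, Set.range (s m)) ⊔ adjoin ℚ (Set.range (s a)) from sup_comm _ _,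
      ← sup_assoc, hstep, hA, Finset.card_insert_of_notMem haS', pow_succ]
    ring

end FinsetTower

/-! ## §2 The headline: sextic and decic towers together -/

section Engine

variable {I : Type} {r : ℕ} {Kf : I → Type} [∀ i, Field (Kf i)] [∀ i, NumberField (Kf i)] [∀ i, IsCMField (Kf i)]
  {i₀ : I} {is : Fin r → I} {τ : Kf i₀ →+* ℂ}
  {A : Fin (r + 1) → AbelianVariety ℂ} {Φ : ∀ j : Fin (r + 1), CMType (Kf (mfSlots i₀ is j))}
  {ι : ∀ j, 𝓞 (Kf (mfSlots i₀ is j)) →+* End (A j)}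
  {θ : ∀ j, Kf (mfSlots i₀ is j) →+* Module.End ℂ (complexBetti (A j).X 1)}

/-- **SEXTIC AND DECIC TOWERS TOGETHER — given ONLY Markman's two theorems.**  `E = A 0 ⊨ (k; {τ})`, `k = Kf i₀` imaginary quadratic; for `m : Fin r`,
`K_m = Kf (is m) ⊇ im m (k)` of degree `2 n_m` with `(n_m, p_m) ∈ {(3, 1), (5, 2)}` and `A (m+1) ⊨ (K_m; Φ (m+1))` with `p_m` members of the type over `τ`
(`(1,2)`-threefolds over sextic fields, `(2,3)`-fivefolds over decic fields, in any order); ONE family `s₀` of `τ`-embeddings such that for every `m` NO `τ`-embedding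
of `K_m` has image inside `ℚ(τk) · ∏_{j < m, n_j = n_m} s₀_j(K_j)` (no `k`-embedding of `K_m` into the compositum of the EARLIER fields OF THE SAME DEGREE).  Then the
Hodge conjecture holds for EVERY product of copies `⨁_j A (κ j)` — any `E^a × ∏ T_m^{b_m} × ∏ F_m^{c_m}` — GIVEN ONLY `Markman2025_weilClasses_algebraic_abelianFourfold`
and `Markman2025_weilClasses_algebraic_hyperbolicSixfold`.  `HC_CM` is NOT asserted. [cite: Markman2025SurveySecant, Thm. 1.2] [cite: Markman2025SecantWeil, Thm 1.5.1]
[cite: Lang2002, VI §1 Thm. 1.1, Cor. 1.6 and V §2 Thm. 2.8] -/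
theorem hodgeConjectureFor_biproduct_comp_of_sexticsDecics_of_towers (hW4 : Markman2025_weilClasses_algebraic_abelianFourfold)
    (hM6 : Markman2025_weilClasses_algebraic_hyperbolicSixfold) (n p : Fin r → ℕ) (hnp : ∀ m, (n m = 3 ∧ p m = 1) ∨ (n m = 5 ∧ p m = 2))
    {N : ℕ} (κ : Fin N → Fin (r + 1)) (h2 : Module.finrank ℚ (Kf i₀) = 2) (hdeg : ∀ m : Fin r, Module.finrank ℚ (Kf (is m)) = 2 * n m)
    (im : ∀ m : Fin r, Kf i₀ →+* Kf (is m)) (hA : ∀ j, IsCMTypeRealisation (Φ j) (A j) (ι j) (θ j)) (hΨ : ∀ σ : Kf i₀ →+* ℂ, σ ∈ (Φ 0).1 ↔ σ = τ)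
    (hp : ∀ m : Fin r, (Finset.univ.filter fun s : Kf (is m) →+* ℂ => s.comp (im m) = τ ∧ s ∈ (Φ m.succ).1).card = p m)
    (s₀ : ∀ m : Fin r, Kf (is m) →+* ℂ) (hs₀ : ∀ m, (s₀ m).comp (im m) = τ)
    (htower : ∀ (m : Fin r) (φ : Kf (is m) →+* ℂ), φ.comp (im m) = τ →
      ¬ Set.range φ ⊆ (↑(adjoin ℚ (Set.range τ) ⊔
        adjoin ℚ (⋃ j ∈ (Finset.univ.filter fun j : Fin r => n j = n m).filter (· < m), Set.range (s₀ j))) : Set ℂ)) :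
    HodgeConjectureFor (⨁ fun j => A (κ j)).dim (⨁ fun j => A (κ j)).X := by
  refine hodgeConjectureFor_biproduct_comp_of_sexticsDecics_of_finrank hW4 hM6 n p hnp κ h2 hdeg im hA hΨ hp fun m₀ _ => ⟨s₀, fun m _ => hs₀ m, ?_⟩
  -- the degree class `S` of `m₀`
  obtain ⟨S, hSdef⟩ : ∃ S : Finset (Fin r), S = Finset.univ.filter fun m => n m = n m₀ := ⟨_, rfl⟩
  have hmemS : ∀ {m}, m ∈ S ↔ n m = n m₀ := fun {m} => by rw [hSdef, Finset.mem_filter]; exact ⟨fun h => h.2, fun h => ⟨Finset.mem_univ _, h⟩⟩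
  have hU : (⋃ (m : Fin r) (_ : n m = n m₀), Set.range (s₀ m)) = ⋃ m ∈ S, Set.range (s₀ m) := by
    ext x
    simp only [Set.mem_iUnion, exists_prop]
    exact ⟨fun ⟨m, hm, hx⟩ => ⟨m, hmemS.2 hm, hx⟩, fun ⟨m, hm, hx⟩ => ⟨m, hmemS.1 hm, hx⟩⟩
  have hP : (∏ m ∈ Finset.univ.filter (fun m => n m = n m₀), n m) = n m₀ ^ S.card := by
    rw [← hSdef]
    exact Finset.prod_eq_pow_card fun m hm => hmemS.1 hm
  -- the tower condition inside the class
  have hKS : ∀ m ∈ S, ∀ φ : Kf (is m) →+* ℂ, φ.comp (im m) = τ →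
      ¬ Set.range φ ⊆ (↑(adjoin ℚ (Set.range τ) ⊔ adjoin ℚ (⋃ j ∈ S.filter (· < m), Set.range (s₀ j))) : Set ℂ) := by
    intro m hm φ hφ
    have h := htower m φ hφ
    rwa [hmemS.1 hm, ← hSdef] at h
  rw [hU, hP]
  rcases hnp m₀ with ⟨h3, -⟩ | ⟨h5, -⟩
  · rw [h3, finrank_adjoin_biUnion_of_cubicTower (K := fun m => Kf (is m)) im s₀ hs₀ S (fun m hm => by rw [hdeg m, hmemS.1 hm, h3, h2]) hKS, h2, mul_comm]
  · rw [h5, finrank_adjoin_biUnion_of_quinticTower (K := fun m => Kf (is m)) im s₀ hs₀ S (fun m hm => by rw [hdeg m, hmemS.1 hm, h5, h2]) hKS, h2,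
      mul_comm]

/-- **Dominated form** of `hodgeConjectureFor_biproduct_comp_of_sexticsDecics_of_towers`. [cite: Markman2025SurveySecant, Thm. 1.2] [cite: Markman2025SecantWeil, Thm 1.5.1] -/
theorem hodgeConjectureFor_of_avDominatedBy_comp_of_sexticsDecics_of_towers (hW4 : Markman2025_weilClasses_algebraic_abelianFourfold)
    (hM6 : Markman2025_weilClasses_algebraic_hyperbolicSixfold) (n p : Fin r → ℕ) (hnp : ∀ m, (n m = 3 ∧ p m = 1) ∨ (n m = 5 ∧ p m = 2))
    {N : ℕ} (κ : Fin N → Fin (r + 1)) (h2 : Module.finrank ℚ (Kf i₀) = 2) (hdeg : ∀ m : Fin r, Module.finrank ℚ (Kf (is m)) = 2 * n m)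
    (im : ∀ m : Fin r, Kf i₀ →+* Kf (is m)) (hA : ∀ j, IsCMTypeRealisation (Φ j) (A j) (ι j) (θ j)) (hΨ : ∀ σ : Kf i₀ →+* ℂ, σ ∈ (Φ 0).1 ↔ σ = τ)
    (hp : ∀ m : Fin r, (Finset.univ.filter fun s : Kf (is m) →+* ℂ => s.comp (im m) = τ ∧ s ∈ (Φ m.succ).1).card = p m)
    (s₀ : ∀ m : Fin r, Kf (is m) →+* ℂ) (hs₀ : ∀ m, (s₀ m).comp (im m) = τ)
    (htower : ∀ (m : Fin r) (φ : Kf (is m) →+* ℂ), φ.comp (im m) = τ →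
      ¬ Set.range φ ⊆ (↑(adjoin ℚ (Set.range τ) ⊔
        adjoin ℚ (⋃ j ∈ (Finset.univ.filter fun j : Fin r => n j = n m).filter (· < m), Set.range (s₀ j))) : Set ℂ))
    {X : AbelianVariety ℂ} (hX : Domination.AVDominatedBy X (⨁ fun j => A (κ j))) : HodgeConjectureFor X.dim X.X :=
  Domination.hodgeConjectureFor_of_avDominatedBy
    (hodgeConjectureFor_biproduct_comp_of_sexticsDecics_of_towers hW4 hM6 n p hnp κ h2 hdeg im hA hΨ hp s₀ hs₀ htower) hX

end Engine

end Summit.HodgeConjecture.CorCM.MultiFieldWeil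

end
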